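import Summits.CriticalPhenomena.PercolationContinuityZ3.Theorems.PercNearOneGluingAdditiveGluingThreeRelaysDefect
import Summits.CriticalPhenomena.PercolationContinuityZ3.Theorems.PercNearOneGluingAdditiveGluingThreeRelaysDeltaMWorld
import Summits.CriticalPhenomena.PercolationContinuityZ3.Theorems.PercNearOneGluingAdditiveGluingKnLemma2
import HarnessLib

/-! # Crux `PercNearOneGluing.AdditiveGluing` (stmt-CriticalPhenomena-4576): three relays —
# (T1) reduced to the all-separated-world defect bound (P2)

Support file (`--supports stmt-CriticalPhenomena-4576`, lead prim-png-lead-4576, line `starglue` v10).  No definitions,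
no named facts, no sorries.  Notation as in `…ThreeRelaysDefect` / `…ThreeRelaysDeltaMWorld`:
`E := A₁₂P₁P₂ − A₁P₁₂P₂ − A₂P₁₂P₁` (`= P₁P₂P₁₂·ε`, `ε = φ₁₂−φ₁−φ₂ ≥ 0` by Kozma–Nitzan's Lemma 2, landed
`stub_knLemma2`), `δ = m₃ − m₁₂`, `μ₃ᴹ := μ(N₁₂ ∩ {a₁↮a₂} ∩ a₃↔b)` (the all-separated world with `b → a₃`),
`D = μ(o↮A, a₃↮b)`.

Chain of reductions for the registered three-relay certificate `stub_regionCertThreeRelays_d2` (T1):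
  (T1) ⟸ (K3a) `E·δ ≤ P₁P₂P₁₂·D`            (`threeRelays_regionCert_of_defectBound`, landed)
       ⟸ (P2)  `E·μ₃ᴹ ≤ P₁P₂P₁₂·D`            (this file: `E ≥ 0` by Lemma 2 and `δ ≤ μ₃ᴹ` by
                                                 `threeRelays_delta_le_mWorld`, landed).
So the first open case of `AdditiveGluing` follows from the single "M-world" inequality
  (P2)  `ε · μ(M ∩ a₃↔b) ≤ μ(o↮A, a₃↮b)`   on the region {a₃ worst, τ(o) < τ₃, m₁₂ < m₃},
numerically `ε·μ(M ∩ a₃↔b) ≤ 0.33 · μ(M ∩ o↮A ∩ a₃↮b)` there (lead's exact engine, adversarial n ≤ 6; LeadMath-prim.md).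
[cite: KozmaNitzan2024, Lemma 2 (p. 6), Theorem 2 (§3.2, pp. 8–9); VandenbergHaggstromKahn2005, Thms. 1.3–1.4]
-/

namespace Summit.CriticalPhenomena.PercolationContinuityZ3.Theorems

open MeasureTheory Set Literature.Probability.LatticeModels Literature.Probability.Percolation

noncomputable section
open Classical

variable {n : ℕ}

/-- **Lemma 2 in the `A/P` notation**: `A₁P₁₂P₂ + A₂P₁₂P₁ ≤ A₁₂P₁P₂`, i.e. `E ≥ 0` (from the landed `stub_knLemma2`
with the landed set-BHK inequalities `stub_bhkSets`). [cite: KozmaNitzan2024, Lemma 2 (p. 6)] -/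
theorem threeRelays_lemma2_E_nonneg (w : Sym2 (Fin n) → unitInterval) (o a₁ a₂ a₃ : Fin n)
    (h12 : a₁ ≠ a₂) (h13 : a₁ ≠ a₃) (h23 : a₂ ≠ a₃) :
    0 ≤ (prodBernoulli w).real ((openConn a₁ a₃)ᶜ ∩ (openConn a₂ a₃)ᶜ ∩ (openConn a₁ o ∪ openConn a₂ o)) *
            (prodBernoulli w).real ((openConn a₁ a₂)ᶜ ∩ (openConn a₁ a₃)ᶜ : Set (BondConfig (Fin n))) *
            (prodBernoulli w).real ((openConn a₂ a₁)ᶜ ∩ (openConn a₂ a₃)ᶜ : Set (BondConfig (Fin n))) -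
          (prodBernoulli w).real ((openConn a₁ a₂)ᶜ ∩ (openConn a₁ a₃)ᶜ ∩ openConn a₁ o) *
            (prodBernoulli w).real ((openConn a₁ a₃)ᶜ ∩ (openConn a₂ a₃)ᶜ : Set (BondConfig (Fin n))) *
            (prodBernoulli w).real ((openConn a₂ a₁)ᶜ ∩ (openConn a₂ a₃)ᶜ : Set (BondConfig (Fin n))) -
          (prodBernoulli w).real ((openConn a₂ a₁)ᶜ ∩ (openConn a₂ a₃)ᶜ ∩ openConn a₂ o) *
            (prodBernoulli w).real ((openConn a₁ a₃)ᶜ ∩ (openConn a₂ a₃)ᶜ : Set (BondConfig (Fin n))) *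
            (prodBernoulli w).real ((openConn a₁ a₂)ᶜ ∩ (openConn a₁ a₃)ᶜ : Set (BondConfig (Fin n))) := by
  have hL := stub_knLemma2 stub_bhkSets n w o a₁ a₂ a₃ h12 h13 h23
  rw [knThm2_openConn_comm o a₁, knThm2_openConn_comm o a₂,
    Set.inter_comm (openConn a₁ o) ((openConn a₁ a₂)ᶜ ∩ (openConn a₁ a₃)ᶜ),
    Set.inter_comm (openConn a₂ o) ((openConn a₂ a₁)ᶜ ∩ (openConn a₂ a₃)ᶜ),
    Set.inter_comm (openConn a₁ o ∪ openConn a₂ o) ((openConn a₁ a₃)ᶜ ∩ (openConn a₂ a₃)ᶜ)] at hL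
  linarith

/-- **(T1) from the M-world defect bound (P2).**  For three distinct relays with `a₃` worst, the inequality
`E · μ(N₁₂ ∩ {a₁↮a₂} ∩ a₃↔b) ≤ P₁P₂P₁₂ · μ(o↮A, a₃↮b)` implies the conclusion of the registered certificate
`stub_regionCertThreeRelays_d2` verbatim.  Proof: `E ≥ 0` (Lemma 2), `m₃ − m₁₂ ≤ μ(N₁₂ ∩ {a₁↮a₂} ∩ a₃↔b)`
(`threeRelays_delta_le_mWorld`), then `threeRelays_regionCert_of_defectBound`.
[cite: KozmaNitzan2024, Theorem 2 (§3.2, pp. 8–9)] -/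
theorem threeRelays_regionCert_of_mWorldDefectBound (w : Sym2 (Fin n) → unitInterval) (o b a₁ a₂ a₃ : Fin n)
    (h12 : a₁ ≠ a₂) (h13 : a₁ ≠ a₃) (h23 : a₂ ≠ a₃)
    (h31 : (prodBernoulli w).real (openConn a₃ b) ≤ (prodBernoulli w).real (openConn a₁ b))
    (h32 : (prodBernoulli w).real (openConn a₃ b) ≤ (prodBernoulli w).real (openConn a₂ b))
    (hP2 : ((prodBernoulli w).real ((openConn a₁ a₃)ᶜ ∩ (openConn a₂ a₃)ᶜ ∩ (openConn a₁ o ∪ openConn a₂ o)) *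
              (prodBernoulli w).real ((openConn a₁ a₂)ᶜ ∩ (openConn a₁ a₃)ᶜ : Set (BondConfig (Fin n))) *
              (prodBernoulli w).real ((openConn a₂ a₁)ᶜ ∩ (openConn a₂ a₃)ᶜ : Set (BondConfig (Fin n))) -
            (prodBernoulli w).real ((openConn a₁ a₂)ᶜ ∩ (openConn a₁ a₃)ᶜ ∩ openConn a₁ o) *
              (prodBernoulli w).real ((openConn a₁ a₃)ᶜ ∩ (openConn a₂ a₃)ᶜ : Set (BondConfig (Fin n))) *
              (prodBernoulli w).real ((openConn a₂ a₁)ᶜ ∩ (openConn a₂ a₃)ᶜ : Set (BondConfig (Fin n))) -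
            (prodBernoulli w).real ((openConn a₂ a₁)ᶜ ∩ (openConn a₂ a₃)ᶜ ∩ openConn a₂ o) *
              (prodBernoulli w).real ((openConn a₁ a₃)ᶜ ∩ (openConn a₂ a₃)ᶜ : Set (BondConfig (Fin n))) *
              (prodBernoulli w).real ((openConn a₁ a₂)ᶜ ∩ (openConn a₁ a₃)ᶜ : Set (BondConfig (Fin n)))) *
          (prodBernoulli w).real ((openConn a₁ a₃)ᶜ ∩ (openConn a₂ a₃)ᶜ ∩ (openConn a₁ a₂)ᶜ ∩ openConn a₃ b) ≤
        (prodBernoulli w).real ((openConn a₁ a₂)ᶜ ∩ (openConn a₁ a₃)ᶜ : Set (BondConfig (Fin n))) *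
            (prodBernoulli w).real ((openConn a₂ a₁)ᶜ ∩ (openConn a₂ a₃)ᶜ : Set (BondConfig (Fin n))) *
            (prodBernoulli w).real ((openConn a₁ a₃)ᶜ ∩ (openConn a₂ a₃)ᶜ : Set (BondConfig (Fin n))) *
          (prodBernoulli w).real
            ((openConn o a₁ ∪ openConn o a₂ ∪ openConn o a₃)ᶜ ∩ (openConn a₃ b)ᶜ : Set (BondConfig (Fin n)))) :
    0 ≤
      (prodBernoulli w).real ((openConn a₁ a₃)ᶜ ∩ (openConn a₂ a₃)ᶜ ∩ (openConn a₁ o ∪ openConn a₂ o)) *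
            (prodBernoulli w).real ((openConn a₁ a₂)ᶜ ∩ (openConn a₁ a₃)ᶜ : Set (BondConfig (Fin n))) *
            (prodBernoulli w).real ((openConn a₂ a₁)ᶜ ∩ (openConn a₂ a₃)ᶜ : Set (BondConfig (Fin n))) *
          ((prodBernoulli w).real ((openConn a₁ a₃)ᶜ ∩ (openConn a₂ a₃)ᶜ ∩ (openConn a₁ b ∩ openConn a₂ b)) -
            (prodBernoulli w).real ((openConn a₁ a₃)ᶜ ∩ (openConn a₂ a₃)ᶜ ∩ openConn a₃ b)) +
        (prodBernoulli w).real ((openConn a₁ a₂)ᶜ ∩ (openConn a₁ a₃)ᶜ ∩ openConn a₁ o) *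
            (prodBernoulli w).real ((openConn a₁ a₃)ᶜ ∩ (openConn a₂ a₃)ᶜ : Set (BondConfig (Fin n))) *
            (prodBernoulli w).real ((openConn a₂ a₁)ᶜ ∩ (openConn a₂ a₃)ᶜ : Set (BondConfig (Fin n))) *
          ((prodBernoulli w).real ((openConn a₁ a₂)ᶜ ∩ (openConn a₁ a₃)ᶜ ∩ openConn a₁ b) -
            (prodBernoulli w).real ((openConn a₁ a₂)ᶜ ∩ (openConn a₁ a₃)ᶜ ∩ (openConn a₂ b ∩ openConn a₃ b))) +
        (prodBernoulli w).real ((openConn a₂ a₁)ᶜ ∩ (openConn a₂ a₃)ᶜ ∩ openConn a₂ o) *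
            (prodBernoulli w).real ((openConn a₁ a₃)ᶜ ∩ (openConn a₂ a₃)ᶜ : Set (BondConfig (Fin n))) *
            (prodBernoulli w).real ((openConn a₁ a₂)ᶜ ∩ (openConn a₁ a₃)ᶜ : Set (BondConfig (Fin n))) *
          ((prodBernoulli w).real ((openConn a₂ a₁)ᶜ ∩ (openConn a₂ a₃)ᶜ ∩ openConn a₂ b) -
            (prodBernoulli w).real ((openConn a₂ a₁)ᶜ ∩ (openConn a₂ a₃)ᶜ ∩ (openConn a₁ b ∩ openConn a₃ b))) +
        (prodBernoulli w).real ((openConn a₁ a₂)ᶜ ∩ (openConn a₁ a₃)ᶜ : Set (BondConfig (Fin n))) *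
            (prodBernoulli w).real ((openConn a₂ a₁)ᶜ ∩ (openConn a₂ a₃)ᶜ : Set (BondConfig (Fin n))) *
            (prodBernoulli w).real ((openConn a₁ a₃)ᶜ ∩ (openConn a₂ a₃)ᶜ : Set (BondConfig (Fin n))) *
          (prodBernoulli w).real
            ((openConn o a₁ ∪ openConn o a₂ ∪ openConn o a₃)ᶜ ∩ (openConn a₃ b)ᶜ : Set (BondConfig (Fin n))) := by
  have hE := threeRelays_lemma2_E_nonneg w o a₁ a₂ a₃ h12 h13 h23
  have hδ := threeRelays_delta_le_mWorld w b a₁ a₂ a₃ h13 h23 h31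
  refine threeRelays_regionCert_of_defectBound w o b a₁ a₂ a₃ h31 h32 (le_trans ?_ hP2)
  exact mul_le_mul_of_nonneg_left hδ hE

end

end Summit.CriticalPhenomena.PercolationContinuityZ3.Theorems
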